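import Summits.HodgeConjecture.HodgeConjecture.Theorems.K2E3KeysThmTwoDepthZeroBranchBInertOdd     -- ★ p862439 (this seat, (W-4)): `exists_eta_of_reducible_of_shellZero` — :155 at an inert odd place ⟸ the shell-zero value `H0`
import Summits.HodgeConjecture.HodgeConjecture.Theorems.K2E3BranchBShellZero                       -- ★ (K2E3-p03 (g9), GREEN 919b271e0ea8251a 2026-09-04T22:34Z): (II)-b3 `integral_Sh_zero` — the shell-zero value at an inert place `v ∤ 2`
import HarnessLib

/-!
# K2 ∕ E3 «EllipticInputs», unit U4 «Keys» — (U4f-χ₁-ram-one-d0B) THE SOCKET :155 AT AN INERT PLACE `v ∤ 2` — PAID (no shell letter left)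
# `i(χ₁, 1)` reducible (χ₁ continuous, non-unitary, contracting, ramified, depth zero, Branch B; `v` non-split, unramified in `L`, `v ∤ 2`) ⟹ `χ₁ = η · ‖·‖^{1∕2}`
# [Keys1984 §3–§5, §7 Thm (2); Casselman1980 §3; Casselman1995 §6.4, Thm. 6.6.2; Rogawski1990 §12.1–§12.2; Roche1998 §3–§4]

Cell `pub/hodgecm-mathlib` (D-0151), crux H413 = `stmt-HodgeConjecture-24833`, route of record `HCCMUnconditional`; chair K2-lead (g2), LINE-LEAD∕dealer K2E3-plan (g5), cell «U4-RAM»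
(Z3-c frame v1, K2E3-p03 (g9)).  Typed by the S1 hand R90-C10-p04 (g0).  THEOREMS ONLY (no `def`, no `instance`, no notation, no named-fact hypothesis, no `sorry`); lane
`--supports stmt-HodgeConjecture-24833 --as helper`, count-neutral.  NOT THE PAYER OF THE LINES SOCKET: :155 quantifies over every non-split `v`; this is its INERT, `v ∤ 2` case in full
(the dyadic-inert case: K2E3-p32 (g2) `…InertAll` chain over ★ (W-2); the ramified case: R90-C10-p05 ∕ R90-C10-p01).

THE POINT.  ★ (W-4) `exists_eta_of_reducible_of_shellZero` left exactly the shell-zero value `H0`; ★ (II)-b3 `K2E3BranchBShellZero.integral_Sh_zero` (K2E3-p03 (g9)) IS `H0` at `v ∤ 2` in the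
agreed binder bytes.  One application.
* **`exists_eta_of_reducible_inert_odd`**.
HONEST LABEL.  HC_CM is proved only modulo the 7 printed citations (2 remaining named inputs: hLiu418 = `stmt-HodgeConjecture-24832`, h413 = `stmt-HodgeConjecture-24833`) until rung 0
closes; count-neutral — no printed citation is discharged; the Lines socket :155 stays OPEN until the dyadic-inert and ramified cases land and the dealer ties it.

## References
* [Keys1984] D. Keys, *Principal series representations of special unitary groups over local fields*, Compositio Math. 51 (1984), §3–§5, §7 Theorem (2) p. 126.
* [Casselman1980] W. Casselman, *The unramified principal series of p-adic groups I*, Compositio Math. 40 (1980), §3.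
* [Casselman1995] W. Casselman, *Introduction to the theory of admissible representations of `p`-adic reductive groups* (1995), §6.4, Thm. 6.6.2.
* [Rogawski1990] J. Rogawski, *Automorphic representations of unitary groups in three variables*, Ann. of Math. Stud. 123 (1990), §12.1 p. 171, §12.2 (1)–(2) p. 173.
* [Roche1998] A. Roche, *Types and Hecke algebras for principal series representations of split reductive p-adic groups*, Ann. Sci. ÉNS (4) 31 (1998), §3–§4.
-/

set_option autoImplicit false
-- the mandated namespace has the single-problem summit's repeated segment (`HodgeConjecture.HodgeConjecture`)
set_option linter.dupNamespace false

noncomputable section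

open NumberField IsDedekindDomain MeasureTheory
open scoped Matrix MatrixGroups WithZero Valued NNReal
open Literature.NumberTheory Literature.NumberTheory.Automorphic Literature.NumberTheory.Automorphic.UnitaryGroup
open Literature.NumberTheory.Rogawski1990

namespace Summit.HodgeConjecture.HodgeConjecture.Cruxes.H413.K2E3KeysThmTwoDepthZeroBranchBInertOddLeaf

open Summit.HodgeConjecture.HodgeConjecture.Cruxes.H413

variable (L : Type) [Field L] [NumberField L] [IsCMField L] (v : HeightOneSpectrum (𝓞 ↥(maximalRealSubfield L)))

open Classical in
set_option maxHeartbeats 4000000 in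
set_option synthInstance.maxHeartbeats 400000 in
-- ★ (W-4) with `H0 :=` ★ `K2E3BranchBShellZero.integral_Sh_zero`
/-- **THE SOCKET :155 AT AN INERT PLACE `v ∤ 2` — PAID.**  `v` non-split, UNRAMIFIED in `L`, `|2|_w = 1` at every `w ∣ v`; `χ₁ : (L ⊗ L⁺_v)ˣ → ℂˣ` continuous, non-unitary, contracting,
NOT trivial on the integral units (ramified), trivial on the principal units (depth zero), `χ₁(u·σu) = 1` on the units of valuation one (Branch B).  If `i(χ₁, 1)` is reducible then
**`χ₁ = η · ‖·‖^{1∕2}` for a continuous quadratic character extension `η`** — the second disjunct of :155.  Proof: ★ (W-4) `exists_eta_of_reducible_of_shellZero` with `H0 :=` ★ (II)-b3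
`integral_Sh_zero`. [cite: Keys1984, §3–§5, §7 Theorem (2) p. 126] [cite: Casselman1980, §3] [cite: Casselman1995, §6.4, Thm. 6.6.2] [cite: Rogawski1990, §12.2 (1)–(2) p. 173] [cite: Roche1998, §3–§4] -/
theorem exists_eta_of_reducible_inert_odd
    (hns : ∀ w' : PlacesOver L v, IsCMField.complexConj L • w'.1 = w'.1) (hunr : Algebra.IsUnramifiedIn (𝓞 L) v.asIdeal)
    (h2 : ∀ w' : PlacesOver L v, Valued.v (2 : w'.1.adicCompletion L) = 1)
    (χ₁ : (LocalRing L v)ˣ →* ℂˣ) (h₁ : Continuous fun x => ((χ₁ x : ℂˣ) : ℂ)) (hnu : ∃ x, ‖((χ₁ x : ℂˣ) : ℂ)‖ ≠ 1)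
    (hcontr : ∀ x : (LocalRing L v)ˣ, unitModulusChar (LocalRing L v) x < 1 → ‖((χ₁ x : ℂˣ) : ℂ)‖ < 1)
    (hram : ¬ (∀ u ∈ (Submonoid.pi Set.univ (fun w : PlacesOver L v => (w.1.adicCompletionIntegers L).toSubring.toSubmonoid)).units, χ₁ u = 1))
    (hdepth : ∀ u : (LocalRing L v)ˣ, (∀ w' : PlacesOver L v, Valued.v (((u : LocalRing L v) w') - 1) < 1) → χ₁ u = 1)
    (hB : ∀ u : (LocalRing L v)ˣ, (∀ w' : PlacesOver L v, Valued.v ((u : LocalRing L v) w') = 1) →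
      χ₁ (u * Units.map (conjLocal L (IsCMField.complexConj L) v : LocalRing L v →* LocalRing L v) u) = 1)
    (hred : ∃ N : Subrepresentation (cmPrincipalSeries L 3 v (cmTorusCharPair L v χ₁ 1)), N ≠ ⊥ ∧ N ≠ ⊤) :
    ∃ η : (LocalRing L v)ˣ →* ℂˣ, IsQuadraticCharExtension (conjLocal L (IsCMField.complexConj L) v) η ∧
      Continuous (fun x => ((η x : ℂˣ) : ℂ)) ∧ χ₁ = η * halfModulusChar (LocalRing L v) :=
  K2E3KeysThmTwoDepthZeroBranchBInertOdd.exists_eta_of_reducible_of_shellZero L v hns hunr h2 χ₁ h₁ hnu hcontr hdepth hB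
    (fun w δ₀ hδσ hδv _ _ μ _ => K2E3BranchBShellZero.integral_Sh_zero L v w (hns w) hunr (h2 w) χ₁ h₁ hdepth hB hram δ₀ hδσ hδv μ)
    hred

end Summit.HodgeConjecture.HodgeConjecture.Cruxes.H413.K2E3KeysThmTwoDepthZeroBranchBInertOddLeaf

end
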